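import Summits.Parity.GeneralizedHardyLittlewood.Theorems.ChenParityOracleBLAPHostParityFromBrickSifting
import Literature.NumberTheory.Sieve.BombieriAsymptoticSieveLemma11T
import HarnessLib

/-!
# Route `ChenParityOracleBLAP` — crux S1 = `HostParityFromBrick` (stmt-Parity-20045): tools for Vaughan's Type-II pieces

Support file for the prime half `K1 → K2 → HP1` of S1 (step (V)): dyadic decomposition of an
outer range (`sum_Ioc_dyadic`), exchange of a hyperbolic double sum (`sum_hyperbolic_comm`), and
the divisor bound for rough integers (`card_divisors_le_log_of_rough`: if `m ≤ x` is coprime to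
`(N−1)#` with `N ≥ exp(log x/log log x)`, then `τ(m) ≤ 2^{Ω(m)} ≤ log x`).

References: H. Iwaniec, E. Kowalski, *Analytic Number Theory* (2004), §13.4 [IwaniecKowalski2004].
-/

namespace Summit.Parity.GeneralizedHardyLittlewood.Theorems

open Finset Real
open scoped ArithmeticFunction.Omega

/-- **Dyadic decomposition**: `∑_{U < b ≤ U·2^J} F(b) = ∑_{j<J} ∑_{U 2^j < b ≤ 2 (U 2^j)} F(b)`. -/
theorem sum_Ioc_dyadic (U J : ℕ) (F : ℕ → ℝ) :
    ∑ b ∈ Ioc U (U * 2 ^ J), F b = ∑ j ∈ range J, ∑ b ∈ Ioc (U * 2 ^ j) (2 * (U * 2 ^ j)), F b := by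
  induction J with
  | zero => simp
  | succ J ih =>
    have h1 : U ≤ U * 2 ^ J := Nat.le_mul_of_pos_right U (by positivity)
    have h2 : U * 2 ^ J ≤ U * 2 ^ (J + 1) :=
      Nat.mul_le_mul_left U (Nat.pow_le_pow_right (by norm_num) (Nat.le_succ J))
    rw [Finset.sum_range_succ, ← ih, ← Finset.sum_Ioc_consecutive F h1 h2]
    congr 2
    rw [pow_succ]; ring

/-- **Exchange of a hyperbolic double sum**:
`∑_{A<m≤y} ∑_{B<n≤y/m} F(m,n) = ∑_{B<n≤y} ∑_{A<m≤y/n} F(m,n)`. -/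
theorem sum_hyperbolic_comm (A B y : ℕ) (F : ℕ → ℕ → ℝ) :
    ∑ m ∈ Ioc A y, ∑ n ∈ Ioc B (y / m), F m n = ∑ n ∈ Ioc B y, ∑ m ∈ Ioc A (y / n), F m n := by
  classical
  -- both sides equal the sum over `{(m,n) ∈ (A,y] × (B,y] : m n ≤ y}`
  have hL : ∑ m ∈ Ioc A y, ∑ n ∈ Ioc B (y / m), F m n =
      ∑ p ∈ ((Ioc A y) ×ˢ (Ioc B y)).filter (fun p : ℕ × ℕ => p.1 * p.2 ≤ y), F p.1 p.2 := by
    rw [Finset.sum_filter, Finset.sum_product]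
    refine Finset.sum_congr rfl fun m hm => ?_
    rw [Finset.mem_Ioc] at hm
    rw [← Finset.sum_filter]
    congr 1
    ext n
    simp only [Finset.mem_Ioc, Finset.mem_filter]
    constructor
    · rintro ⟨h1, h2⟩
      have h3 : n * m ≤ y := (Nat.le_div_iff_mul_le (by omega)).1 h2
      refine ⟨⟨h1, ?_⟩, by rw [mul_comm]; exact h3⟩
      exact le_trans (Nat.le_mul_of_pos_right n (by omega)) h3
    · rintro ⟨⟨h1, -⟩, h3⟩
      exact ⟨h1, (Nat.le_div_iff_mul_le (by omega)).2 (by rw [mul_comm]; exact h3)⟩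
  have hR : ∑ n ∈ Ioc B y, ∑ m ∈ Ioc A (y / n), F m n =
      ∑ p ∈ ((Ioc A y) ×ˢ (Ioc B y)).filter (fun p : ℕ × ℕ => p.1 * p.2 ≤ y), F p.1 p.2 := by
    rw [Finset.sum_filter, Finset.sum_product_right]
    refine Finset.sum_congr rfl fun n hn => ?_
    rw [Finset.mem_Ioc] at hn
    rw [← Finset.sum_filter]
    congr 1
    ext m
    simp only [Finset.mem_Ioc, Finset.mem_filter]
    constructor
    · rintro ⟨h1, h2⟩
      have h3 : m * n ≤ y := (Nat.le_div_iff_mul_le (by omega)).1 h2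
      exact ⟨⟨h1, le_trans (Nat.le_mul_of_pos_right m (by omega)) h3⟩, h3⟩
    · rintro ⟨⟨h1, -⟩, h3⟩
      exact ⟨h1, (Nat.le_div_iff_mul_le (by omega)).2 h3⟩
  rw [hL, hR]

/-- **Divisors of rough integers.**  If `m ≠ 0`, `m ≤ x`, `m` is coprime to `(N−1)#`,
`exp(log x/log log x) ≤ N` and `x ≥ 16`, then `τ(m) ≤ log x`. -/
theorem card_divisors_le_log_of_rough {x N m : ℕ} (hx : (16 : ℝ) ≤ x) (hm : m ≠ 0) (hmx : m ≤ x)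
    (hN : Real.exp (Real.log x / Real.log (Real.log x)) ≤ N)
    (hcop : Nat.Coprime m (primorial (N - 1))) :
    ((m.divisors.card : ℕ) : ℝ) ≤ Real.log x := by
  have hx1 : (1 : ℝ) < x := by linarith
  have hlogx : 1 < Real.log x := by
    rw [← Real.log_exp 1]
    refine Real.log_lt_log (Real.exp_pos 1) ?_
    have := Real.exp_one_lt_d9; linarith
  have hllx : 0 < Real.log (Real.log x) := Real.log_pos hlogx
  have hN1 : (1 : ℝ) < N := lt_of_lt_of_le (by
    have : 0 < Real.log x / Real.log (Real.log x) := by positivity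
    calc (1 : ℝ) = Real.exp 0 := (Real.exp_zero).symm
      _ < _ := Real.exp_lt_exp.2 this) hN
  have hlogN : Real.log x / Real.log (Real.log x) ≤ Real.log N := by
    have := Real.log_le_log (Real.exp_pos _) hN; rwa [Real.log_exp] at this
  have hlogN0 : 0 < Real.log N := Real.log_pos hN1
  -- prime factors of `m` are `≥ N`
  have hfac : ∀ p ∈ m.primeFactors, N ≤ p := (coprime_primorial_iff hm).1 hcop
  have hpow := Literature.NumberTheory.Sieve.BombieriSieve.pow_cardFactors_le hm hfac
  have htau := Literature.NumberTheory.Sieve.BombieriSieve.card_divisors_le_two_pow_cardFactors hm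
  -- `Ω log N ≤ log m ≤ log x`, so `Ω ≤ log log x`
  have hΩ : (Ω m : ℝ) * Real.log N ≤ Real.log x := by
    have h1 : ((N ^ Ω m : ℕ) : ℝ) ≤ x := by exact_mod_cast hpow.trans hmx
    have h2 : Real.log ((N : ℝ) ^ Ω m) ≤ Real.log x := by
      push_cast at h1
      exact Real.log_le_log (by positivity) h1
    rwa [Real.log_pow] at h2
  have hΩ' : (Ω m : ℝ) ≤ Real.log (Real.log x) := by
    have h1 : (Ω m : ℝ) ≤ Real.log x / Real.log N := by rw [le_div_iff₀ hlogN0]; exact hΩ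
    refine h1.trans ?_
    rw [div_le_iff₀ hlogN0]
    calc Real.log x = Real.log x / Real.log (Real.log x) * Real.log (Real.log x) := by field_simp
      _ ≤ Real.log N * Real.log (Real.log x) := mul_le_mul_of_nonneg_right hlogN hllx.le
      _ = Real.log (Real.log x) * Real.log N := mul_comm _ _
  -- `τ(m) ≤ 2^Ω ≤ e^Ω ≤ log x`
  calc ((m.divisors.card : ℕ) : ℝ) ≤ ((2 ^ Ω m : ℕ) : ℝ) := by exact_mod_cast htau
    _ = (2 : ℝ) ^ (Ω m : ℝ) := by push_cast; rw [Real.rpow_natCast]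
    _ ≤ Real.exp 1 ^ (Ω m : ℝ) := by
        refine Real.rpow_le_rpow (by norm_num) ?_ (Nat.cast_nonneg _)
        have := Real.add_one_le_exp (1 : ℝ); linarith
    _ = Real.exp (Ω m) := by rw [← Real.exp_one_rpow (Ω m : ℝ)]
    _ ≤ Real.exp (Real.log (Real.log x)) := Real.exp_le_exp.2 hΩ'
    _ = Real.log x := Real.exp_log (by linarith)

end Summit.Parity.GeneralizedHardyLittlewood.Theorems
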